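/-
Copyright (c) 2026 the pub-hodgecm-mathlib formalisation cell (harness21).  Prover seat hodgecm-mathlib-K2E3-p12 (g4), Track B «K2-LIT» ∕ h413
(`stmt-HodgeConjecture-24833`), line `K2_E3_EllipticInputs`, unit U12-d, §L (G⁺-b, reduction): FOURIER REGULARITY OF `J(𝒩)^{det⁻¹(D)}(𝔤𝔩₂(F))` FROM THE REGULARITY OF THE
CLASS ORBITAL INTEGRALS `ν̂_{𝒪_a}`.  2026-09-04.
-/
import Summits.HodgeConjecture.HodgeConjecture.Theorems.K2E3GL2NilpotentOrbitsDetClass           -- ★ p857116 (this seat): structure `T = a₀δ₀ + Σ cᵢ ν_{𝒪ᵢ}` for `det⁻¹(D)`-invariant `T ∈ J(𝒩)`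
import Summits.HodgeConjecture.HodgeConjecture.Theorems.K2E3GL2NilpotentFourierRegularOfStructure -- ★ p856788 (K2E3-p12 g3): `exists_bound_sqrt_normAbs_discr`; brings `isLocSmooth_matrixFourier`
import HarnessLib

/-!
# K2_E3 road (h413), §L — (G⁺-b, reduction): `(L-B_GL)^{D}` on `𝔤𝔩₂(F)` ⟸ Fourier regularity of each class orbital integral `ν_{𝒪_{aᵢ}}`

Cell `pub/hodgecm-mathlib` (D-0151), Track B, seat K2E3-p12 (g4), §L line lead (road «U-iso-T»).  `--supports stmt-HodgeConjecture-24833 --as helper`; count-neutral plumbing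
toward the residual (LBU-2⁺) «(L-B_GL)^{Nm} on `𝔤𝔩₂(L⁺_v)`» of ★ p857300 (`D = Nm(L_wˣ)`-classes, two orbits).

* §1 `fourierRegular_of_eq_delta_add_sum` — if `T f = a₀·f(0) + Σᵢ cᵢ·νᵢ(f)` on `C_c^∞(𝔤𝔩₂(F))` and each `νᵢ ∘ 𝓕` is represented by a locally integrable `Frᵢ`, locally constant on
  `{disc ∈ Fˣ}` with `|disc|^{1∕2}·‖Frᵢ‖` locally bounded, then `T ∘ 𝓕` is represented by `a₀ + Σᵢ cᵢ Frᵢ` with the same three properties (★ p856788 pattern, finite sums).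
* §2 **`detSubgroup_nilpotentFourierRegular_of_orbits`** — THE HEAD: `D ≤ Fˣ` open with squares, representatives `a : ι → Fˣ` of `Fˣ∕D`; IF every class orbital integral
  `νᵢ(f) = ∫_{chart⁻¹ 𝒪_{aᵢ}} f(k·tE₁₂·k⁻¹) d(κ⊗dx)` has a regular Fourier transform (hypothesis `hB`, one function `Frᵢ` per class), THEN every `T` on `C_c^∞(𝔤𝔩₂(F))` with
  (i) (ii) (iv) and `Ad(g)`-invariance for `det g ∈ D` has one too — ★ p857116 `nilpotentStructure_of_detSubgroup` + §1.  At `D = Fˣ` this is ★ p856788; at `D =` the norm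
  classes it is (LBU-2⁺) modulo «reg(ν̂_{𝒪±})» — the two genuinely analytic statements left on the §L road.

HONEST LABEL: HC_CM is proved only modulo the 7 printed citations (2 remaining named inputs: hLiu418 = stmt-HodgeConjecture-24832, h413 = stmt-HodgeConjecture-24833)
until rung 0 closes; count-neutral plumbing.

References: [HarishChandra1999AdmissibleDistributions] Harish-Chandra (DeBacker–Sally) (1999), Thm. 3.9, Cor. 3.10 p. 10, Thm. 4.4 p. 11, Lemma 5.2;
[BernsteinZelevinsky1976] Bernstein–Zelevinsky (1976), §1.18; [Howe1974] Howe, Math. Ann. 208 (1974), Prop. 3.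
-/

set_option autoImplicit false
set_option linter.dupNamespace false   -- `Summit.HodgeConjecture.HodgeConjecture.…` (D-0017 nested layout; lakefile exemption for Summits)

noncomputable section

open MeasureTheory Measure Filter Topology
open scoped MatrixGroups NNReal ENNReal
open Literature.NumberTheory.Rogawski1990 Literature.NumberTheory.Automorphic Literature.NumberTheory.Automorphic.LocalFieldHaar
open Literature.NumberTheory.GaloisRepresentations Literature.NumberTheory.GaloisRepresentations.IsNonarchimedeanLocalField
open Summit.HodgeConjecture.HodgeConjecture.Cruxes.H413.K2E3GLnNilpotentFourierPointSupport (isLocSmooth_matrixFourier matrixFourier_apply_zero)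
open Summit.HodgeConjecture.HodgeConjecture.Cruxes.H413.K2E3GL2NilpotentFourierRegularOfStructure (exists_bound_sqrt_normAbs_discr)
open Summit.HodgeConjecture.HodgeConjecture.Cruxes.H413.K2E3GL2NilpotentOrbitsDetClass (nilpotentStructure_of_detSubgroup)

namespace Summit.HodgeConjecture.HodgeConjecture.Cruxes.H413.K2E3GL2NmNilpotentFourierRegularOfOrbits

variable {F : Type*} [Field F] [ValuativeRel F] [TopologicalSpace F] [IsNonarchimedeanLocalField F]

/-! ## §1  `T = a₀δ₀ + Σ cᵢνᵢ` with each `ν̂ᵢ` regular gives `T̂` regular -/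

section Sum

variable (ψ : AddChar F Circle) [MeasurableSpace (Matrix (Fin 2) (Fin 2) F)] [BorelSpace (Matrix (Fin 2) (Fin 2) F)] (μ𝔤 : Measure (Matrix (Fin 2) (Fin 2) F)) [μ𝔤.IsAddHaarMeasure]

/-- **Assembly over a finite family of functionals**: `T f = a₀·f(0) + Σᵢ cᵢ·νᵢ(f)` and `νᵢ(𝓕f) = ∫ f·Frᵢ` with `Frᵢ` locally integrable, locally constant on `{disc ∈ Fˣ}`,
`|disc|^{1∕2}·‖Frᵢ‖` locally bounded ⟹ the four (L-B_GL)-properties for `T` with `Fn = a₀ + Σᵢ cᵢ Frᵢ`. [cite: HarishChandra1999AdmissibleDistributions, Cor. 3.10 p. 10, Thm. 4.4 p. 11] -/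
theorem fourierRegular_of_eq_delta_add_sum (hψ : ψ.IsContinuousNontrivial) (T : ((Matrix (Fin 2) (Fin 2) F) → ℂ) → ℂ) (a₀ : ℂ) {ι : Type*} [Fintype ι] (c : ι → ℂ)
    (ν : ι → ((Matrix (Fin 2) (Fin 2) F) → ℂ) → ℂ)
    (hab : ∀ f : (Matrix (Fin 2) (Fin 2) F) → ℂ, IsLocSmooth f → T f = a₀ * f 0 + ∑ i, c i * ν i f)
    (Fr : ι → (Matrix (Fin 2) (Fin 2) F) → ℂ) (hFr_int : ∀ i, LocallyIntegrable (Fr i) μ𝔤)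
    (hFr_rep : ∀ i (f : (Matrix (Fin 2) (Fin 2) F) → ℂ), IsLocSmooth f → ν i (fun Y : Matrix (Fin 2) (Fin 2) F => ∫ X, ((ψ (Matrix.trace (Y * X)) : Circle) : ℂ) * f X ∂μ𝔤) = ∫ X, f X * Fr i X ∂μ𝔤)
    (hFr_lc : ∀ i (X : Matrix (Fin 2) (Fin 2) F), IsUnit X.charpoly.discr → ∀ᶠ Y in 𝓝 X, Fr i Y = Fr i X)
    (hFr_bd : ∀ i (C : Set (Matrix (Fin 2) (Fin 2) F)), IsCompact C → ∃ B : ℝ, ∀ X ∈ C, ((NNReal.sqrt (normAbs F X.charpoly.discr) : ℝ≥0) : ℝ) * ‖Fr i X‖ ≤ B) :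
    LocallyIntegrable (fun X => a₀ + ∑ i, c i * Fr i X) μ𝔤 ∧
      (∀ f : (Matrix (Fin 2) (Fin 2) F) → ℂ, IsLocSmooth f → T (fun Y : Matrix (Fin 2) (Fin 2) F => ∫ X, ((ψ (Matrix.trace (Y * X)) : Circle) : ℂ) * f X ∂μ𝔤) = ∫ X, f X * (a₀ + ∑ i, c i * Fr i X) ∂μ𝔤) ∧
      (∀ X : Matrix (Fin 2) (Fin 2) F, IsUnit X.charpoly.discr → ∀ᶠ Y in 𝓝 X, (a₀ + ∑ i, c i * Fr i Y) = a₀ + ∑ i, c i * Fr i X) ∧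
      (∀ C : Set (Matrix (Fin 2) (Fin 2) F), IsCompact C → ∃ B : ℝ, ∀ X ∈ C, ((NNReal.sqrt (normAbs F X.charpoly.discr) : ℝ≥0) : ℝ) * ‖a₀ + ∑ i, c i * Fr i X‖ ≤ B) := by
  classical
  haveI : T2Space F := (isLocalField F).toT2Space
  haveI : LocallyCompactSpace F := (isLocalField F).toLocallyCompactSpace
  haveI : LocallyCompactSpace (Matrix (Fin 2) (Fin 2) F) := Pi.locallyCompactSpace_of_finite
  have hsum_int : LocallyIntegrable (fun X => ∑ i, c i * Fr i X) μ𝔤 := by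
    refine locallyIntegrable_finsetSum Finset.univ (f := fun i X => c i * Fr i X) fun i _ => ?_
    have := (hFr_int i).smul (c i)
    simpa only [Pi.smul_def, smul_eq_mul] using this
  refine ⟨(locallyIntegrable_const a₀).add hsum_int, fun f hf => ?_, fun X hX => ?_, fun C hC => ?_⟩
  · -- the representation
    have hFf : IsLocSmooth (fun Y : Matrix (Fin 2) (Fin 2) F => ∫ X, ((ψ (Matrix.trace (Y * X)) : Circle) : ℂ) * f X ∂μ𝔤) := isLocSmooth_matrixFourier hψ μ𝔤 hf
    rw [hab _ hFf, matrixFourier_apply_zero ψ μ𝔤 f]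
    have hfi : Integrable f μ𝔤 := hf.continuous.integrable_of_hasCompactSupport hf.2
    have hfFr : ∀ i, Integrable (fun X => f X * Fr i X) μ𝔤 := fun i => by
      have := (hFr_int i).integrable_smul_left_of_hasCompactSupport hf.continuous hf.2
      simpa only [smul_eq_mul] using this
    have hsplit : (fun X => f X * (a₀ + ∑ i, c i * Fr i X)) = fun X => a₀ * f X + ∑ i, c i * (f X * Fr i X) := by
      funext X
      rw [mul_add, Finset.mul_sum, mul_comm (f X) a₀]
      congr 1
      exact Finset.sum_congr rfl fun i _ => by ring
    rw [hsplit, integral_add (hfi.const_mul a₀) (integrable_finsetSum _ fun i _ => (hfFr i).const_mul (c i)), integral_const_mul,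
      integral_finsetSum _ fun i _ => (hfFr i).const_mul (c i)]
    congr 1
    exact Finset.sum_congr rfl fun i _ => by rw [integral_const_mul, hFr_rep i f hf]
  · -- local constancy
    have h := fun i => hFr_lc i X hX
    have hall : ∀ᶠ Y in 𝓝 X, ∀ i, Fr i Y = Fr i X := Filter.eventually_all.2 h
    exact hall.mono fun Y hY => by simp only [hY]
  · -- the weighted bound
    obtain ⟨M₀, hM₀, hM⟩ := exists_bound_sqrt_normAbs_discr (F := F) hC
    choose B hB using fun i => hFr_bd i C hC
    refine ⟨M₀ * ‖a₀‖ + ∑ i, ‖c i‖ * B i, fun X hX => ?_⟩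
    have hD0 : 0 ≤ ((NNReal.sqrt (normAbs F X.charpoly.discr) : ℝ≥0) : ℝ) := NNReal.coe_nonneg _
    calc ((NNReal.sqrt (normAbs F X.charpoly.discr) : ℝ≥0) : ℝ) * ‖a₀ + ∑ i, c i * Fr i X‖
        ≤ ((NNReal.sqrt (normAbs F X.charpoly.discr) : ℝ≥0) : ℝ) * (‖a₀‖ + ∑ i, ‖c i‖ * ‖Fr i X‖) := by
          refine mul_le_mul_of_nonneg_left ((norm_add_le _ _).trans (add_le_add le_rfl ?_)) hD0
          exact (norm_sum_le _ _).trans (Finset.sum_le_sum fun i _ => by rw [norm_mul])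
      _ = ((NNReal.sqrt (normAbs F X.charpoly.discr) : ℝ≥0) : ℝ) * ‖a₀‖ + ∑ i, ‖c i‖ * (((NNReal.sqrt (normAbs F X.charpoly.discr) : ℝ≥0) : ℝ) * ‖Fr i X‖) := by
          rw [mul_add, Finset.mul_sum]
          congr 1
          exact Finset.sum_congr rfl fun i _ => by ring
      _ ≤ M₀ * ‖a₀‖ + ∑ i, ‖c i‖ * B i :=
          add_le_add (mul_le_mul_of_nonneg_right (hM X hX) (norm_nonneg _))
            (Finset.sum_le_sum fun i _ => mul_le_mul_of_nonneg_left (hB i X hX) (norm_nonneg _))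

end Sum

/-! ## §2  The head: `(L-B_GL)^{D}` from the class orbital integrals -/

section Head

variable (D : Subgroup Fˣ) (ψ : AddChar F Circle) [MeasurableSpace (Matrix (Fin 2) (Fin 2) F)] [BorelSpace (Matrix (Fin 2) (Fin 2) F)] (μ𝔤 : Measure (Matrix (Fin 2) (Fin 2) F)) [μ𝔤.IsAddHaarMeasure]
  [MeasurableSpace F] [BorelSpace F] [MeasurableSpace (GL (Fin 2) F)] [BorelSpace (GL (Fin 2) F)]
  (κ : Measure ↥(glInt 2 F)) [IsHaarMeasure κ] (dx : Measure F) [dx.IsAddHaarMeasure]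

/-- **`(L-B_GL)^{D}` ON `𝔤𝔩₂(F)` FROM THE REGULARITY OF THE CLASS ORBITAL INTEGRALS.**  `D ≤ Fˣ` open containing the squares, `a : ι → Fˣ` representatives of `Fˣ∕D`;
hypothesis `hB`: for each class `i` the orbital integral over `chart⁻¹(𝒪_{aᵢ})`, `𝒪_{aᵢ} = Ad(det⁻¹D)·aᵢE₁₂`, composed with `𝓕`, is a locally integrable function `Frᵢ`, locally constant on
`{disc ∈ Fˣ}`, `|disc|^{1∕2}·‖Frᵢ‖` locally bounded.  Conclusion: every `T` on `C_c^∞(𝔤𝔩₂(F))` with (i) (ii) (iv) and `Ad(g)`-invariance for `det g ∈ D` has `T ∘ 𝓕 = ∫ · Fn` with the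
same three properties (★ p857116 structure + §1). [cite: HarishChandra1999AdmissibleDistributions, Thm. 3.9, Cor. 3.10 p. 10, Thm. 4.4 p. 11] [cite: BernsteinZelevinsky1976, §1.18] -/
theorem detSubgroup_nilpotentFourierRegular_of_orbits (hψ : ψ.IsContinuousNontrivial) (hDo : IsOpen (D : Set Fˣ)) (hD2 : ∀ u : Fˣ, u * u ∈ D)
    {ι : Type*} [Fintype ι] (a : ι → Fˣ) (hcov : ∀ u : Fˣ, ∃ i, (a i)⁻¹ * u ∈ D) (hdis : ∀ i j, i ≠ j → (a i)⁻¹ * a j ∉ D)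
    (hB : ∀ i, ∃ Fr : (Matrix (Fin 2) (Fin 2) F) → ℂ, LocallyIntegrable Fr μ𝔤 ∧
      (∀ f : (Matrix (Fin 2) (Fin 2) F) → ℂ, IsLocSmooth f →
        ∫ p in {p : ↥(glInt 2 F) × F | (((p.1 : GL (Fin 2) F) : Matrix (Fin 2) (Fin 2) F) * !![0, p.2; 0, 0] * ((((p.1 : GL (Fin 2) F))⁻¹ : GL (Fin 2) F) : Matrix (Fin 2) (Fin 2) F)) ∈ MulAction.orbit ↥((D.comap (Matrix.GeneralLinearGroup.det : GL (Fin 2) F →* Fˣ)).comap (ConjAct.ofConjAct : ConjAct (GL (Fin 2) F) ≃* GL (Fin 2) F).toMonoidHom) (!![0, (a i : F); 0, 0] : Matrix (Fin 2) (Fin 2) F)}, (fun Y : Matrix (Fin 2) (Fin 2) F => ∫ X, ((ψ (Matrix.trace (Y * X)) : Circle) : ℂ) * f X ∂μ𝔤) (((p.1 : GL (Fin 2) F) : Matrix (Fin 2) (Fin 2) F) * !![0, p.2; 0, 0] * ((((p.1 : GL (Fin 2) F))⁻¹ : GL (Fin 2) F) : Matrix (Fin 2) (Fin 2) F)) ∂(κ.prod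 dx) = ∫ X, f X * Fr X ∂μ𝔤) ∧
      (∀ X : Matrix (Fin 2) (Fin 2) F, IsUnit X.charpoly.discr → ∀ᶠ Y in 𝓝 X, Fr Y = Fr X) ∧
      (∀ C : Set (Matrix (Fin 2) (Fin 2) F), IsCompact C → ∃ B : ℝ, ∀ X ∈ C, ((NNReal.sqrt (normAbs F X.charpoly.discr) : ℝ≥0) : ℝ) * ‖Fr X‖ ≤ B))
    (T : ((Matrix (Fin 2) (Fin 2) F) → ℂ) → ℂ)
    (hT1 : ∀ f₁ f₂ : (Matrix (Fin 2) (Fin 2) F) → ℂ, IsLocSmooth f₁ → IsLocSmooth f₂ → T (f₁ + f₂) = T f₁ + T f₂)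
    (hT2 : ∀ (c : ℂ) (f : (Matrix (Fin 2) (Fin 2) F) → ℂ), IsLocSmooth f → T (c • f) = c * T f)
    (hT3 : ∀ g : GL (Fin 2) F, Matrix.GeneralLinearGroup.det g ∈ D → ∀ f : (Matrix (Fin 2) (Fin 2) F) → ℂ, IsLocSmooth f →
      T (fun X => f ((g : Matrix (Fin 2) (Fin 2) F) * X * ((g⁻¹ : GL (Fin 2) F) : Matrix (Fin 2) (Fin 2) F))) = T f)
    (hT4 : ∀ f : (Matrix (Fin 2) (Fin 2) F) → ℂ, IsLocSmooth f → (∀ X ∈ tsupport f, ¬ IsNilpotent X) → T f = 0) :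
    ∃ Fn : (Matrix (Fin 2) (Fin 2) F) → ℂ, LocallyIntegrable Fn μ𝔤 ∧
      (∀ f : (Matrix (Fin 2) (Fin 2) F) → ℂ, IsLocSmooth f → T (fun Y : Matrix (Fin 2) (Fin 2) F => ∫ X, ((ψ (Matrix.trace (Y * X)) : Circle) : ℂ) * f X ∂μ𝔤) = ∫ X, f X * Fn X ∂μ𝔤) ∧
      (∀ X : Matrix (Fin 2) (Fin 2) F, IsUnit X.charpoly.discr → ∀ᶠ Y in 𝓝 X, Fn Y = Fn X) ∧
      (∀ C : Set (Matrix (Fin 2) (Fin 2) F), IsCompact C → ∃ B : ℝ, ∀ X ∈ C, ((NNReal.sqrt (normAbs F X.charpoly.discr) : ℝ≥0) : ℝ) * ‖Fn X‖ ≤ B) := by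
  obtain ⟨a₀, c, hab⟩ := nilpotentStructure_of_detSubgroup D hDo hD2 a hcov hdis κ dx T hT1 hT2 hT3 hT4
  choose Fr hFr_int hFr_rep hFr_lc hFr_bd using hB
  exact ⟨fun X => a₀ + ∑ i, c i * Fr i X,
    fourierRegular_of_eq_delta_add_sum ψ μ𝔤 hψ T a₀ c
      (fun i f => ∫ p in {p : ↥(glInt 2 F) × F | (((p.1 : GL (Fin 2) F) : Matrix (Fin 2) (Fin 2) F) * !![0, p.2; 0, 0] * ((((p.1 : GL (Fin 2) F))⁻¹ : GL (Fin 2) F) : Matrix (Fin 2) (Fin 2) F)) ∈ MulAction.orbit ↥((D.comap (Matrix.GeneralLinearGroup.det : GL (Fin 2) F →* Fˣ)).comap (ConjAct.ofConjAct : ConjAct (GL (Fin 2) F) ≃* GL (Fin 2) F).toMonoidHom) (!![0, (a i : F); 0, 0] : Matrix (Fin 2) (Fin 2) F)}, f (((p.1 : GL (Fin 2) F) : Matrix (Fin 2) (Fin 2) F) * !![0, p.2; 0, 0] * ((((p.1 : GL (Fin 2) F))⁻¹ : GL (Fin 2) F) : Matrix (Fin 2) (Fin 2) F)) ∂(κ.prod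 dx))
      hab Fr hFr_int (fun i f hf => hFr_rep i f hf) hFr_lc hFr_bd⟩

end Head

end Summit.HodgeConjecture.HodgeConjecture.Cruxes.H413.K2E3GL2NmNilpotentFourierRegularOfOrbits

end
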